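import Summits.ABC.IUTFork.LanaEtaLimThetaInf
import Literature.IUT.HodgeArakelov.CohomologyLimitKummerRestrict
import HarnessLib

/-!
# L-LANA objects XI octies: `θ(Π_v)` presented as Kummer classes of FUNCTIONS — the evaluation law on `θ` is
# then the naturality of Kummer classes under evaluation ([EtTh] Prop. 1.3/1.4 shape), hence a theorem

Record-only support file (D-0012; seat abc-iut-c312-4 gen 7, L-LANA level, plan/LLANA-SPEC N14 Steps 2, 5–7 and
N13 "Kummer map … functoriality"); TAKES NO SIDE on [IUTchIII] Cor. 3.12. Companion of `LanaEtaLimThetaInf.lean`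
(gen 7: the evaluation law on `∞θ(Π_v)` follows from the law on `θ(Π_v)`) and gen 5's `LanaEtaLim.lean` (p424629).
LANA §6.1 p. 32 (functoriality of Kummer maps for morphisms of pairs, then): "These observations will be used
below, in the special case of a point `Spec k → X`. The above discussion then lets us interpret the induced map
on `H¹` as a Kummer-theoretic analogue of evaluation of functions at such a point."; §6.2 (f) p. 35 (Step 5,
restriction to the decomposition groups `D_t`, display (6-3)): "When applied to Kummer classes associated to
functions, this restriction operation can be interpreted as the Kummer-theoretic analogue of evaluation at the
points associated to the decomposition groups in question; see §6.1."; §6.2 (c) p. 34, display (6-1)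
`θ(Π_v) ⊆ H¹(Π_{v,Ÿ}, (l·Δ_Θ)(Π_v))`: "This subset is the functorially reconstructed set of `μ_l`-multiples of the
reciprocal of the “`(l·ℤ × μ_2)`-orbit of an `l`-th root of the étale theta function of standard type”
[11, Prop. 1.4, pp. 237–238]"; §6.2 (g) pp. 35–36 (`κ_t`, `φ_{v,t}`, the containment). [EtTh] Prop. 1.3 p. 21 (the
Kummer classes of the theta function and of its roots — our summary, not a quotation), Prop. 1.4 (ii)/(iii)
pp. 21–22 (its values at the labelled torsion points are `q`-powers times units, hence INTEGRAL — our summary).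
v2 (doc-only, declarations' statements and proofs byte-identical): v1 presented two RECONSTRUCTED sentences as LANA
print (referee lane q, DEFECT d9 OBS); the quotations above and in the docstrings of `h1LimRestrict_thetaClassOf` /
`EtaLimSide.FunctionData` are now VERBATIM, and (6-1) is located on p. 34.
[cite: LANA2026Report, §6.1 p. 32, §6.2 (c) p. 34, §6.2 (f) p. 35, §6.2 (g) pp. 35–36] [cite: MochizukiEtTh2009, Prop 1.3 p.21]

WHAT IS HERE (classical Kummer theory, [cite: NeukirchSchmidtWingberg2008, I §5]; abc-iut-w4-d004's
`CohomologyLimitKummerEvaluation` (E1) is the same mechanism in the pull-back-along-a-section shape `ι : G_v → Π`;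
here in LANA's restriction-to-`D_t ≤ Π_{v,Ÿ}` shape of Fig. 3, inside ONE group `Π`):
§1 `kummerContClass_eval` — at a fixed subgroup `H₁ ≤ Π`: for a module of "functions" `M` and of "constants" `A`
   (both `Π`-groups), an `H₁`-equivariant evaluation `ev : M →* A` and coefficient data with `c_A ∘ Λ(ev) = c_M`,
   the continuous Kummer class of an `H₁`-fixed `f ∈ M` IS the continuous Kummer class of its value `ev f`
   (same cocycle); `h1LimRestrict_thetaClassOf` — in the limits: **restricting to `D ≤ H` the level-`⊤` class
   `θ_f ∈ ∞H¹(H, A')` of an `H`-fixed function `f` gives abc-iut-w4-d007's Kummer class `κ_D(ev f) ∈ ∞H¹(D, A')`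
   of its VALUE** (`res_D θ_f = κ_D(ev f)`, LANA's "Kummer-theoretic analogue of evaluation").
§2 `EtaLimSide.FunctionData S M` (data): the theta classes `θ(Π_v)` of gen 5's `EtaLimSide` PRESENTED as the
   level-`⊤` Kummer classes of `Π_{v,Ÿ}`-fixed functions `ϑ` (with compatible roots), evaluations `ev_t : M → K̄_vˣ`
   at the labelled points, `D_t`-equivariant and compatible with the synchronization, with INTEGRAL VALUES
   `ev_t(ϑ) ∈ O^▷` — the [EtTh] Prop. 1.3 / 1.4 (ii)(iii) content as DATA. THEN: **`eval_thetaClasses_of_functionData`**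
   — the evaluation law on `θ(Π_v)` HOLDS (`res_thetaClassOf_eq_kappaD`: `res_t θ_ϑ = κ_t(ev_t ϑ)` label-wise); with
   gen 7's `∞θ`-closure (`LanaEtaLimThetaInf`, p437211): `eval_thetaInfSet_of_functionData`, and
   **`containment_of_functionData`** — LANA's CONTAINMENT (§6.2 (g) p. 36) ⟸ `KummerImageEq` ∧ such a presentation
   (synchronization bijective, `O^▷` root-closed); `factors_of_functionData` (§9.1 (f) factorisation, `κ_{D_t}` injective).
   NON-VACUITY: `FunctionData.ofConstants` — constants ARE functions (`M := K̄_vˣ`, `ev_t := id`): every record whose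
   theta classes are Kummer classes of `Π_{v,Ÿ}`-fixed integral constants carries a presentation (honest label:
   DEGENERATE witness; the genuine one is [EtTh]'s theta function on the tempered coverings).
HONEST SCOPE: nothing here asserts that the genuine theta classes of [IUTchII] Prop. 1.4 at layer L6's model admit
such a presentation with integral values at the [IUTchII] §2 evaluation points — that is [EtTh] Prop. 1.4 +
[IUTchII] Cor. 2.5 at the genuine data (layers L2/L6: abc-iut-L2-t12 `ThetaKummerInput`, abc-iut-w4-d004 (E2));
this file isolates it as MODULE-LEVEL DATA in place of a cohomological hypothesis. NOT here: any judgement.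
-/

noncomputable section

namespace Summit.ABC
namespace IUTFork

open Literature.AnabelianGeometry.EtaleTheta
open Literature.IUT.HodgeArakelov
open Literature.IUT.HodgeArakelov.CohomologySystemOfContH1

/-! ## 1. Kummer classes of functions restrict to Kummer classes of values -/

section Eval

variable {P : TopGroup.{0}} {G' : Type} [Group G'] [TopologicalSpace G'] [IsTopologicalGroup G']
  (φ : P →* G') (A' : Subgroup G') [A'.Normal] [IsMulCommutative A']
  {M : Type} [CommGroup M] [MulDistribMulAction P M] [TopologicalSpace M]
  {A : Type} [CommGroup A] [MulDistribMulAction P A] [TopologicalSpace A]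

/-- **Fixed level.** For an `H₁`-equivariant evaluation `ev : M →* A` (`ev (h • f) = h • ev f`, `h ∈ H₁`) and
coefficient data `c_M` over `M`, `c_A` over `A` with `c_A ∘ Λ(ev) = c_M`: the continuous Kummer class over `H₁` of
an `H₁`-fixed function `f` (root system `x`) equals the continuous Kummer class of its value `ev f` (root system
`x.map ev`) — the cocycles `h ↦ c_M((h•x_n/x_n)_n)` and `h ↦ c_A((h•ev x_n/ev x_n)_n)` coincide.
[cite: NeukirchSchmidtWingberg2008, I §5] [cite: LANA2026Report, §6.1 p. 32] -/
theorem kummerContClass_eval {H₁ : Subgroup P} (ev : M →* A)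
    (hev : ∀ (h : H₁) (f : M), ev ((h : P) • f) = (h : P) • ev f)
    (cM : CyclotomeCoefficients φ A' M) (cA : CyclotomeCoefficients φ A' A)
    (hc : ∀ ζ : cyclotome M, cA.hom (cyclotome.map ev ζ) = cM.hom ζ) {f : M} (x : RootSystem f)
    (hf : f ∈ MulAction.fixedPoints H₁ M) (hx : ∀ n : ℕ+, IsOpen (MulAction.stabilizer P (x.root n) : Set P))
    (hf₀ : ev f ∈ MulAction.fixedPoints H₁ A)
    (hx₀ : ∀ n : ℕ+, IsOpen (MulAction.stabilizer P ((x.map ev).root n) : Set P)) :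
    cM.kummerContClass H₁ x hf hx = cA.kummerContClass H₁ (x.map ev) hf₀ hx₀ := by
  rw [CyclotomeCoefficients.kummerContClass, CyclotomeCoefficients.kummerContClass]
  refine ContH1.mk_congr _ (funext fun y => ?_) _ _
  rw [← hc]
  congr 1
  refine Subtype.ext (funext fun n => ?_)
  rw [cyclotome.map_apply, RootSystem.kummerCocycle_apply, RootSystem.kummerCocycle_apply, RootSystem.map_root,
    Subgroup.smul_def, Subgroup.smul_def, map_div, hev]

variable (H : Subgroup P)

omit [TopologicalSpace M] in
/-- An `H`-fixed element is `H ⊓ K`-fixed. [cite: NeukirchSchmidtWingberg2008, I §5] -/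
theorem mem_fixedPoints_inf_of_mem_fixedPoints (K : Subgroup P) {f : M} (hf : f ∈ MulAction.fixedPoints H M) :
    f ∈ MulAction.fixedPoints ↥(H ⊓ K) M :=
  fun h => hf ⟨h.1, h.2.1⟩

/-- **The class `θ_f ∈ ∞H¹(H, A') = lim_K H¹(H ⊓ K, A')` of an `H`-fixed function `f`**: the image at level `K = ⊤`
(`H¹(H, A')` itself, LANA (6-1) "`θ(Π_v) ⊆ H¹(Π_{v,Ÿ}, (l·Δ_Θ)(Π_v))`") of its continuous Kummer class computed from
a compatible root system `x` whose members have open stabilisers. [cite: LANA2026Report, §6.2 (c) p. 34]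
[cite: MochizukiEtTh2009, Prop 1.3 p.21] -/
def thetaClassOf (cM : CyclotomeCoefficients φ A' M) {f : M} (x : RootSystem f)
    (hf : f ∈ MulAction.fixedPoints H M) (hx : ∀ n : ℕ+, IsOpen (MulAction.stabilizer P (x.root n) : Set P)) :
    Multiplicative (h1Lim φ A' H ⊥) :=
  Multiplicative.ofAdd (h1Of φ A' H ⊥ (Idx.top ⊥)
    (Additive.ofMul (cM.kummerContClass (H ⊓ (Idx.top ⊥).K) x
      (mem_fixedPoints_inf_of_mem_fixedPoints H _ hf) hx)))

variable [RootableBy A ℕ] (c : CyclotomeCoefficients φ A' A)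
  (hA : ∀ b : A, IsOpen (MulAction.stabilizer P b : Set P)) (hfi : ∀ b : A, (MulAction.stabilizer P b).FiniteIndex)

/-- **`res_D θ_f = κ_D(ev f)`** — "When applied to Kummer classes associated to functions, this restriction
operation can be interpreted as the Kummer-theoretic analogue of evaluation at the points associated to the
decomposition groups in question" (§6.2 (f) p. 35) IN THE KERNEL: for `D ≤ H`, a `D`-equivariant evaluation
`ev : M →* A` into a discrete rootable module of constants and coefficient data with `c ∘ Λ(ev) = c_M`, restricting
the class `θ_f` of an `H`-fixed function to `∞H¹(D, A')` (abc-iut-L6's `h1LimRestrict`) gives abc-iut-w4-d007's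
Kummer class `κ_D(ev f)` of its value. [cite: LANA2026Report, §6.1 p. 32, §6.2 (f) p. 35] [cite: NeukirchSchmidtWingberg2008, I §5] -/
theorem h1LimRestrict_thetaClassOf {D : Subgroup P} (hDH : D ≤ H) (cM : CyclotomeCoefficients φ A' M) (ev : M →* A)
    (hev : ∀ (h : D) (f : M), ev ((h : P) • f) = (h : P) • ev f)
    (hc : ∀ ζ : cyclotome M, c.hom (cyclotome.map ev ζ) = cM.hom ζ) {f : M} (x : RootSystem f)
    (hf : f ∈ MulAction.fixedPoints H M) (hx : ∀ n : ℕ+, IsOpen (MulAction.stabilizer P (x.root n) : Set P)) :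
    h1LimRestrict φ A' hDH ⊥ (Multiplicative.toAdd (thetaClassOf φ A' H cM x hf hx)) =
      Multiplicative.toAdd (h1LimKummer φ A' D c hA hfi (ev f)) := by
  -- the value is `D`-fixed: `h • ev f = ev (h • f) = ev f`
  have hfD : f ∈ MulAction.fixedPoints D M := fun h => hf ⟨h.1, hDH h.2⟩
  have hevf : ev f ∈ MulAction.fixedPoints ↥(D ⊓ (Idx.top (⊥ : Subgroup P)).K) A := fun h => by
    have h1 : ev ((h : P) • f) = (h : P) • ev f := hev ⟨h.1, h.2.1⟩ f
    have h2 : (h : P) • f = f := hfD ⟨h.1, h.2.1⟩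
    change (h : P) • ev f = ev f
    rw [← h1, h2]
  rw [thetaClassOf, toAdd_ofAdd, h1LimRestrict_of]
  -- level-wise restriction of the Kummer class is the Kummer class over `D ⊓ ⊤` (same cocycle, `rfl`)
  change h1Of φ A' D ⊥ (Idx.top ⊥) (Additive.ofMul (cM.kummerContClass (D ⊓ (Idx.top (⊥ : Subgroup P)).K) x
    (mem_fixedPoints_inf_of_mem_fixedPoints D _ hfD) hx)) = _
  rw [kummerContClass_eval φ A' (H₁ := D ⊓ (Idx.top (⊥ : Subgroup P)).K) ev (fun h g => hev ⟨h.1, h.2.1⟩ g) cM c hc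
      x _ hx hevf (fun _ => hA _),
    ← kummerGmod_eq_of_rootSystem φ A' D c hA (Idx.top ⊥) (ev f) hevf (x.map ev),
    ← h1LimKummerFun_eq_h1Of φ A' D c hA hfi (ev f) (Idx.top ⊥) hevf]
  rfl

/-- Hence `res_D θ_f` lies in the Kummer image `κ_D(O)` of any submonoid `O ∋ ev f` ("the value is integral").
[cite: LANA2026Report, §6.2 (g) p. 36] -/
theorem h1LimRestrict_thetaClassOf_mem {D : Subgroup P} (hDH : D ≤ H) (cM : CyclotomeCoefficients φ A' M)
    (ev : M →* A) (hev : ∀ (h : D) (f : M), ev ((h : P) • f) = (h : P) • ev f)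
    (hc : ∀ ζ : cyclotome M, c.hom (cyclotome.map ev ζ) = cM.hom ζ) {f : M} (x : RootSystem f)
    (hf : f ∈ MulAction.fixedPoints H M) (hx : ∀ n : ℕ+, IsOpen (MulAction.stabilizer P (x.root n) : Set P))
    (O : Submonoid A) (hO : ev f ∈ O) :
    AddMonoidHom.toMultiplicative (h1LimRestrict φ A' hDH ⊥) (thetaClassOf φ A' H cM x hf hx) ∈
      MonoidHom.mrange (h1LimKummerOn φ A' D c hA hfi O) :=
  ⟨⟨ev f, hO⟩, congrArg Multiplicative.ofAdd (h1LimRestrict_thetaClassOf φ A' H c hA hfi hDH cM ev hev hc x hf hx).symm⟩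

end Eval

/-! ## 2. `θ(Π_v)` presented by functions: the evaluation law on `θ` HOLDS, and LANA's Containment follows -/

namespace EtaLimSide

variable {P : TopGroup.{0}} {G' : Type} [Group G'] [TopologicalSpace G'] [IsTopologicalGroup G']
  {φ : P →* G'} {A' : Subgroup G'} [A'.Normal] [IsMulCommutative A'] {H : Subgroup P}
  {A : Type} [CommGroup A] [MulDistribMulAction P A] [TopologicalSpace A] [RootableBy A ℕ]
  (S : EtaLimSide φ A' H A) (M : Type) [CommGroup M] [MulDistribMulAction P M] [TopologicalSpace M]

/-- **A presentation of `θ(Π_v)` by functions** ([EtTh] Prop. 1.3 / 1.4 content as DATA over gen 5's Fig. 3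
record `S`): a `Π`-module `M` of functions with a synchronization `c_M : Λ(M) → (l·Δ_Θ)` for it; a family `ϑ_i`
of `Π_{v,Ÿ}`-fixed functions (cf. (6-1), p. 34: "an `l`-th root of the étale theta function") with compatible root
systems whose members have open stabilisers, such that `θ(Π_v)` consists of their level-`⊤` classes; at every
label `t` an evaluation `ev_t : M → K̄_vˣ` at the point under `t`, `D_t`-equivariant, compatible with the
synchronizations (`c ∘ Λ(ev_t) = c_M` — at the model: roots of unity are constants), with INTEGRAL VALUES
`ev_t(ϑ_i) ∈ O^▷` (our reading of [EtTh] Prop. 1.4 (ii)/(iii): the values at the labelled points are `q`-powers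
times units). [cite: LANA2026Report, §6.2 (c) p. 34, §6.2 (g) pp. 35–36] [cite: MochizukiEtTh2009, Prop 1.4 p.21] -/
structure FunctionData where
  /-- synchronization for the function module, `Λ(M) → (l·Δ_Θ)(Π_v)` -/
  cM : CyclotomeCoefficients φ A' M
  /-- index set of the presenting functions -/
  ι : Type
  /-- the presenting functions `ϑ_i` -/
  fn : ι → M
  /-- each `ϑ_i` is fixed by `Π_{v,Ÿ}` -/
  fixed : ∀ i, fn i ∈ MulAction.fixedPoints H M
  /-- a compatible system of roots of each `ϑ_i` -/
  root : ∀ i, RootSystem (fn i)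
  /-- whose members have open stabilisers in `Π_v` -/
  isOpen_stabilizer_root : ∀ i (n : ℕ+), IsOpen (MulAction.stabilizer P ((root i).root n) : Set P)
  /-- `θ(Π_v)` consists of the classes of the `ϑ_i` -/
  thetaClasses_subset : S.thetaClasses ⊆ Set.range fun i => thetaClassOf φ A' H cM (root i) (fixed i)
    (isOpen_stabilizer_root i)
  /-- evaluation at the point labelled `t` -/
  ev : S.T → (M →* A)
  /-- `ev_t` is `D_t`-equivariant -/
  ev_smul : ∀ t (h : S.D t) (f : M), ev t ((h : P) • f) = (h : P) • ev t f
  /-- compatibility of the synchronizations along `ev_t` -/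
  c_map_ev : ∀ t (ζ : cyclotome M), S.c.hom (cyclotome.map (ev t) ζ) = cM.hom ζ
  /-- the values of the `ϑ_i` at the labelled points are integral -/
  ev_fn_mem : ∀ t i, ev t (fn i) ∈ S.O

variable {S M}

/-- **The evaluation law on `θ(Π_v)` HOLDS for a presentation by functions**: every theta class restricts at
every `D_t` to `κ_t` of the (integral) value of the presenting function (`h1LimRestrict_thetaClassOf`).
[cite: LANA2026Report, §6.1 p. 32, §6.2 (g) p. 36] -/
theorem eval_thetaClasses_of_functionData (F : S.FunctionData M) :
    ∀ t, ∀ x ∈ S.thetaClasses, S.toEtaSteps.res t x ∈ MonoidHom.mrange (S.toEtaSteps.kappa t) := by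
  intro t x hx
  obtain ⟨i, rfl⟩ := F.thetaClasses_subset hx
  exact h1LimRestrict_thetaClassOf_mem φ A' H S.c S.hA S.hfi (S.D_le t) F.cM (F.ev t) (F.ev_smul t)
    (F.c_map_ev t) (F.root i) (F.fixed i) (F.isOpen_stabilizer_root i) S.O (F.ev_fn_mem t i)

/-- Label-wise form: **`res_t θ_{ϑ_i} = κ_t(ev_t ϑ_i)`** in gen 5's Fig. 3 record (`res_t` = L6 `h1LimRestrict`,
`κ_t` = abc-iut-w4-d007 `h1LimKummer` at `D_t` along `c`). [cite: LANA2026Report, §6.2 (f) p. 35, §6.2 (g) p. 35] -/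
theorem res_thetaClassOf_eq_kappaD (F : S.FunctionData M) (t : S.T) (i : F.ι) :
    S.toEtaSteps.res t (thetaClassOf φ A' H F.cM (F.root i) (F.fixed i) (F.isOpen_stabilizer_root i)) =
      S.kappaD t (F.ev t (F.fn i)) :=
  congrArg Multiplicative.ofAdd (h1LimRestrict_thetaClassOf φ A' H S.c S.hA S.hfi (S.D_le t) F.cM (F.ev t)
    (F.ev_smul t) (F.c_map_ev t) (F.root i) (F.fixed i) (F.isOpen_stabilizer_root i))

/-! ### Non-vacuity: constants are functions -/

omit [TopologicalSpace M] in
/-- `Λ(id) = id` on cyclotomes. [cite: LANA2026Report, §6.1 p. 32] -/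
theorem cyclotome_map_id (ζ : cyclotome M) : cyclotome.map (MonoidHom.id M) ζ = ζ :=
  Subtype.ext (funext fun _ => rfl)

variable (S) in
/-- **NON-VACUITY (degenerate, honest): constants presented as functions.** For ANY family `a_i` of
`Π_{v,Ÿ}`-fixed INTEGRAL constants whose `Π_{v,Ÿ}`-level Kummer classes contain `θ(Π_v)`, the record carries a
`FunctionData` with `M := K̄_vˣ`, `c_M := c`, `ev_t := id` (root systems from rootability; stabilisers open by `hA`).
The genuine presentation is [EtTh]'s theta function on the tempered coverings `Ÿ`, not a constant — this witness
only certifies that the typed fields are jointly satisfiable over every `S`. [cite: LANA2026Report, §6.2 (c) p. 34] -/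
def FunctionData.ofConstants {ι : Type} (a : ι → A) (ha : ∀ i, a i ∈ MulAction.fixedPoints H A)
    (haO : ∀ i, a i ∈ S.O)
    (hθ : S.thetaClasses ⊆ Set.range fun i =>
      thetaClassOf φ A' H S.c (RootSystem.ofRootableBy (a i)) (ha i) fun _ => S.hA _) :
    S.FunctionData A where
  cM := S.c
  ι := ι
  fn := a
  fixed := ha
  root i := RootSystem.ofRootableBy (a i)
  isOpen_stabilizer_root _ _ := S.hA _
  thetaClasses_subset := hθ
  ev _ := MonoidHom.id A
  ev_smul _ _ _ := rfl
  c_map_ev _ ζ := congrArg S.c.hom (cyclotome_map_id ζ)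
  ev_fn_mem _ i := haO i

/-- In particular a record with NO theta classes (`θ = ∅`, e.g. gen 5's model `ofDoubleUnderline C c ∅ …`) carries
the empty presentation. [cite: LANA2026Report, §6.2 (c) p. 34] -/
theorem nonempty_functionData_of_thetaClasses_eq_empty (hθ : S.thetaClasses = ∅) : Nonempty (S.FunctionData A) :=
  ⟨FunctionData.ofConstants S (ι := PEmpty) (fun i => nomatch i) (fun i => nomatch i) (fun i => nomatch i)
    (by rw [hθ]; exact Set.empty_subset _)⟩

/-! ### LANA's Containment from a presentation by functions -/

/-- With gen 7's `∞θ`-closure (`eval_thetaInfSet_of_thetaClasses`): the evaluation law on `∞θ(Π_v)` holds for a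
presentation by functions, a bijective synchronization and a root-closed `O^▷`.
[cite: LANA2026Report, §6.2 (d) p. 34, §6.2 (g) p. 36] -/
theorem eval_thetaInfSet_of_functionData (hc : Function.Bijective S.c.hom)
    (hroot : ∀ (a : A) (n : ℕ), 0 < n → a ^ n ∈ S.O → a ∈ S.O) (F : S.FunctionData M) :
    ∀ t, ∀ x ∈ S.thetaInfSet, S.toEtaSteps.res t x ∈ MonoidHom.mrange (S.toEtaSteps.kappa t) :=
  S.eval_thetaInfSet_of_thetaClasses hc hroot (eval_thetaClasses_of_functionData F)

/-- **LANA's CONTAINMENT from the Kummer-image link and a presentation of `θ(Π_v)` by functions with integral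
values** (synchronization bijective, `O^▷` root-closed): "the image of `ψ_v` … is contained in the image of `φ_v`"
(§6.2 (g) p. 36) — NO cohomological hypothesis is left: what remains is MODULE-LEVEL DATA of [EtTh] Prop. 1.3/1.4
shape and the Frobenioid-side link `KummerImageEq` (p. 34). [cite: LANA2026Report, §6.2 (g) p. 36]
[cite: Mochizuki2012, Cor 2.5 p.71] -/
theorem containment_of_functionData (hc : Function.Bijective S.c.hom)
    (hroot : ∀ (a : A) (n : ℕ), 0 < n → a ^ n ∈ S.O → a ∈ S.O) (hK : S.toEtaSteps.KummerImageEq)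
    (F : S.FunctionData M) : S.toEtaSteps.Containment :=
  S.containment_of_eval_thetaClasses hc hroot hK (eval_thetaClasses_of_functionData F)

/-- … and the §9.1 (f) factorisation of `ψ_v` through `φ_v` EXISTS (uniquely: gen 5 `factorisation_unique_of`) when
the `κ_{D_t}` are injective. [cite: LANA2026Report, §9.1 (f) p. 45] -/
theorem factors_of_functionData (hc : Function.Bijective S.c.hom) (hinj : ∀ t, Function.Injective (S.kappaD t))
    (hroot : ∀ (a : A) (n : ℕ), 0 < n → a ^ n ∈ S.O → a ∈ S.O) (hK : S.toEtaSteps.KummerImageEq)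
    (F : S.FunctionData M) : S.toEtaSteps.Factors :=
  S.factors_of_eval_thetaClasses hc hinj hroot hK (eval_thetaClasses_of_functionData F)

end EtaLimSide

end IUTFork

end Summit.ABC

end
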